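import Literature.Topology.FourManifolds.HomotopyBallSliceProofs
import Literature.Topology.FourManifolds.ProjectiveTowerConcordanceProofs
import Literature.Topology.FourManifolds.EquidimensionalEmbedding
import Literature.Topology.FourManifolds.ClosedBallProofs
import Literature.Topology.FourManifolds.CircleNbhdTransport
import Literature.Geometry.Manifold.OpenEmbeddingCriterion
import Literature.Geometry.Manifold.SmoothEmbeddingCodRestrict
import Literature.Geometry.Manifold.SmoothEmbeddingInverse
import Mathlib.MeasureTheory.Function.Jacobian
import Mathlib.MeasureTheory.Measure.Haar.OfBasis
import Mathlib.MeasureTheory.Measure.Lebesgue.EqHaar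
import HarnessLib
import HarnessLib.Audit.Tags

/-!
# Slice disc data: shrinking, general position of a puncture, transport into `S⁴`

Solo informed SmoothPoincare4, session 19 — the tool file of `SoloInformedPuncturedEmbedding.lean`
(see there for the mathematics and the sources).  For a slice disc datum `(e, f)` of a knot `K` in a
smooth 4-manifold `M` (`Literature.Topology.FourManifolds.Knot.IsSliceDiscIn`, Manolescu–Piccirillo
2023, Def. 2.1) this file proves, with no facts assumed:

* `isSliceDiscIn_shrink` — precomposing ball and disc with the radial diffeomorphisms
  `univBall 0 √2 : ℝⁿ ≅ B(0, √2)` (identity on the unit spheres, preserving the unit balls) gives a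
  slice disc datum whose maps have images `e(B(0,√2))`, `f(B(0,√2))`;
* `exists_norm_gt_apply_notMem_image` — general position of a point against a disc: some `e y`,
  `‖y‖ > 2`, misses `f(C)`; the bad set `{y | e y ∈ f(ℝ²)}` is the image of a planar set under the
  `C¹` map `e⁻¹ ∘ f ∘ π`, hence Lebesgue-null (mini-Sard,
  `MeasureTheory.addHaar_image_eq_zero_of_differentiableOn_of_addHaar_eq_zero`);
* `isSliceDiscIn_transport_opens` — a datum landing in an open `V ⊆ M` is carried by a
  diffeomorphism `ψ : V ≅ U ⊆ S⁴` onto an open subset of the round sphere to a slice disc datum in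
  `S⁴` (the differential of `ψ` is injective because `ψ⁻¹ ∘ ψ = id` near every point).

Sources: C. Manolescu, L. Piccirillo, *From zero surgeries to candidates for exotic definite
4-manifolds*, J. Lond. Math. Soc. 108 (2023), Def. 2.1 [ManolescuPiccirillo2023]; J. M. Lee,
*Introduction to Smooth Manifolds*, 2nd ed. (2013), Prop. 5.2, Thm. 6.10 (sets of measure zero
under smooth maps) [LeeSmoothManifolds2013].  No new axioms, no `sorry`.
-/

noncomputable section

open scoped Manifold ContDiff Topology
open Set Function ContinuousMap MeasureTheory

namespace Summit.SmoothPoincare4.SmoothPoincare4.Theorems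

open Literature.Topology.FourManifolds Literature.Geometry.Manifold

/-- Local notation: `𝔼 n` is the model Euclidean space `EuclideanSpace ℝ (Fin n)`. -/
local notation "𝔼 " n:arg => EuclideanSpace ℝ (Fin n)

/-- Local notation: `𝕊 n` is the unit sphere in `EuclideanSpace ℝ (Fin (n + 1))`. -/
local notation "𝕊 " n:arg => (Metric.sphere (0 : EuclideanSpace ℝ (Fin (n + 1))) 1)

/-- Local notation: `𝔻²` is the closed unit disc in `ℝ²`. -/
local notation "𝔻²" => Metric.closedBall (0 : EuclideanSpace ℝ (Fin 2)) 1

/-! ### Tool 1: a retraction onto an open subset -/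

open Classical in
/-- Retraction of `X` onto an open subset `V` (identity on `V`, junk elsewhere). [folklore] -/
def retractOpens {X : Type*} [TopologicalSpace X] (V : TopologicalSpace.Opens X) (v₀ : V)
    (z : X) : V :=
  if hz : z ∈ V then ⟨z, hz⟩ else v₀

/-- `retractOpens` is the identity on `V`. [folklore] -/
theorem retractOpens_of_mem {X : Type*} [TopologicalSpace X] (V : TopologicalSpace.Opens X)
    (v₀ : V) {z : X} (hz : z ∈ V) : retractOpens V v₀ z = ⟨z, hz⟩ := by
  simp [retractOpens, hz]

/-- `retractOpens V v₀` is smooth on `V`. [folklore] -/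
theorem contMDiffOn_retractOpens {X : Type*} [TopologicalSpace X] [ChartedSpace (𝔼 4) X]
    (V : TopologicalSpace.Opens X) (v₀ : V) :
    ContMDiffOn (𝓡 4) (𝓡 4) ∞ (retractOpens V v₀) V := by
  intro z hz
  rw [← ContMDiffWithinAt.subtypeVal_comp_iff]
  refine contMDiffWithinAt_id.congr (fun y hy ↦ ?_) ?_
  · show ((retractOpens V v₀ y : V) : X) = y
    rw [retractOpens_of_mem V v₀ hy]
  · show ((retractOpens V v₀ z : V) : X) = z
    rw [retractOpens_of_mem V v₀ hz]

/-! ### Tool 2: transport of a slice disc datum along a diffeomorphism of an open subset onto an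
open subset of `S⁴` -/

/-- **Transport along an open embedding.** If a slice disc datum `(e, f)` for `K` in `M` has both
maps landing in an open subset `V ⊆ M` and `ψ : V ≅ U` is a diffeomorphism onto an open subset of
`S⁴`, then `K` has a slice disc datum in `S⁴`. [folklore] -/
theorem isSliceDiscIn_transport_opens {K : Knot}
    {M : Type} [TopologicalSpace M] [ChartedSpace (𝔼 4) M] [IsManifold (𝓡 4) ∞ M]
    {e : 𝔼 4 → M} {f : 𝔼 2 → M} (h : K.IsSliceDiscIn M e f)
    (V : TopologicalSpace.Opens M) (heV : ∀ y, e y ∈ V) (hfV : ∀ x, f x ∈ V)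
    {U : TopologicalSpace.Opens (𝕊 4)} (ψ : V ≃ₘ⟮𝓡 4, 𝓡 4⟯ U) :
    ∃ (e' : 𝔼 4 → 𝕊 4) (f' : 𝔼 2 → 𝕊 4), K.IsSliceDiscIn (𝕊 4) e' f' := by
  have hn : (∞ : ℕ∞ω) ≠ 0 := by simp
  set v₀ : V := ⟨e 0, heV 0⟩ with hv₀
  -- total extensions of `val ∘ ψ` and of `val ∘ ψ⁻¹`
  set Φ : M → 𝕊 4 := fun z ↦ ((ψ (retractOpens V v₀ z) : U) : 𝕊 4) with hΦ
  set Ψ : 𝕊 4 → M := fun w ↦ ((ψ.symm (Knot.toOpens U (ψ v₀) w) : V) : M) with hΨ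
  have hΦV : ContMDiffOn (𝓡 4) (𝓡 4) ∞ Φ V :=
    (contMDiff_subtype_val.comp ψ.contMDiff).comp_contMDiffOn (contMDiffOn_retractOpens V v₀)
  have hΨU : ContMDiffOn (𝓡 4) (𝓡 4) ∞ Ψ U :=
    (contMDiff_subtype_val.comp ψ.symm.contMDiff).comp_contMDiffOn
      (Knot.contMDiffOn_toOpens (ψ v₀))
  have hΦmem : ∀ z ∈ (V : Set M), Φ z ∈ (U : Set (𝕊 4)) := fun z _ ↦ (ψ _).2
  have hΨΦ : ∀ z ∈ (V : Set M), Ψ (Φ z) = z := by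
    intro z hz
    simp [hΦ, hΨ, retractOpens_of_mem V v₀ hz, Knot.toOpens_of_mem (ψ v₀) (ψ ⟨z, hz⟩).2]
  have hΦinj : InjOn Φ V := fun z hz z' hz' hzz' ↦ by rw [← hΨΦ z hz, ← hΨΦ z' hz', hzz']
  -- the differential of `Φ` is injective on `V` (chain rule applied to `Ψ ∘ Φ = id` near `z`)
  have hΦat : ∀ z ∈ (V : Set M), MDifferentiableAt (𝓡 4) (𝓡 4) Φ z := fun z hz ↦
    ((hΦV z hz).contMDiffAt (V.isOpen.mem_nhds hz)).mdifferentiableAt hn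
  have hΦd : ∀ z ∈ (V : Set M), Injective (mfderiv (𝓡 4) (𝓡 4) Φ z) := by
    intro z hz
    have hzV : (V : Set M) ∈ 𝓝 z := V.isOpen.mem_nhds hz
    have h2 : MDifferentiableAt (𝓡 4) (𝓡 4) Ψ (Φ z) :=
      ((hΨU _ (hΦmem z hz)).contMDiffAt (U.isOpen.mem_nhds (hΦmem z hz))).mdifferentiableAt hn
    have hcomp : mfderiv (𝓡 4) (𝓡 4) (Ψ ∘ Φ) z =
        (mfderiv (𝓡 4) (𝓡 4) Ψ (Φ z)).comp (mfderiv (𝓡 4) (𝓡 4) Φ z) :=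
      mfderiv_comp z h2 (hΦat z hz)
    have hid : mfderiv (𝓡 4) (𝓡 4) (Ψ ∘ Φ) z = ContinuousLinearMap.id ℝ _ := by
      have hev : (Ψ ∘ Φ) =ᶠ[𝓝 z] id :=
        Filter.mem_of_superset hzV fun y hy ↦ by simpa using hΨΦ y hy
      rw [hev.mfderiv_eq, mfderiv_id]
    intro v w hvw
    have key := congrArg (mfderiv (𝓡 4) (𝓡 4) Ψ (Φ z)) hvw
    rw [← ContinuousLinearMap.comp_apply, ← ContinuousLinearMap.comp_apply, ← hcomp, hid] at key
    exact key
  -- the transported ball is a smooth embedding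
  set eV : 𝔼 4 → V := fun y ↦ ⟨e y, heV y⟩ with heVdef
  have heV' : Manifold.IsSmoothEmbedding (𝓡 4) (𝓡 4) ∞ eV :=
    h.isSmoothEmbedding.opensCodRestrict V heV
  have he' : Manifold.IsSmoothEmbedding (𝓡 4) (𝓡 4) ∞ (Subtype.val ∘ ((ψ : V → U) ∘ eV)) :=
    Manifold.IsSmoothEmbedding.subtypeVal_comp U (heV'.diffeomorph_comp ψ)
  have hΦe : Φ ∘ e = Subtype.val ∘ ((ψ : V → U) ∘ eV) := by
    funext y
    simp [hΦ, heVdef, retractOpens_of_mem V v₀ (heV y)]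
  refine ⟨Φ ∘ e, Φ ∘ f, ?_, ?_, ?_, ?_, ?_, ?_⟩
  · rw [hΦe]; exact he'
  · exact hΦV.comp_contMDiff h.contMDiff hfV
  · exact hΦinj.comp h.injOn fun x _ ↦ hfV x
  · intro x hx
    rw [mfderiv_comp x (hΦat _ (hfV x)) (h.contMDiff.mdifferentiableAt hn)]
    exact (hΦd _ (hfV x)).comp (h.mfderiv_injective hx)
  · rintro x hx ⟨y, hy, hxy⟩
    exact h.apply_notMem hx ⟨y, hy, hΦinj (heV y) (hfV x) hxy⟩
  · intro x
    show Φ (f x) = Φ (e (K x))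
    rw [h.apply_sphere x]

/-! ### Tool 3: shrinking ball and disc by `univBall 0 √2` -/

section Shrink

open OpenPartialHomeomorph Knot.Puncture

/-- `0 < √2`. [folklore] -/
theorem sqrt_two_pos : (0 : ℝ) < √2 := by positivity

/-- `‖univBall 0 √2 x‖ < 1 ↔ ‖x‖ < 1`. [folklore] -/
theorem norm_univBall_sqrt_two_lt_one_iff {E : Type*} [NormedAddCommGroup E]
    [InnerProductSpace ℝ E] (x : E) : ‖univBall (0 : E) (√2) x‖ < 1 ↔ ‖x‖ < 1 := by
  rw [norm_univBall_zero sqrt_two_pos]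
  set t := ‖x‖ with ht
  have ht0 : 0 ≤ t := norm_nonneg x
  have hs : 0 < √(1 + t ^ 2) := Real.sqrt_pos.2 (by positivity)
  rw [show √2 * (√(1 + t ^ 2))⁻¹ * t = (√2 * t) / √(1 + t ^ 2) by ring, div_lt_one hs,
    Real.lt_sqrt (by positivity), mul_pow, Real.sq_sqrt (by norm_num : (0:ℝ) ≤ 2)]
  constructor
  · intro h1; nlinarith
  · intro h1; nlinarith

/-- `‖univBall 0 √2 x‖ ≤ 1 ↔ ‖x‖ ≤ 1`. [folklore] -/
theorem norm_univBall_sqrt_two_le_one_iff {E : Type*} [NormedAddCommGroup E]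
    [InnerProductSpace ℝ E] (x : E) : ‖univBall (0 : E) (√2) x‖ ≤ 1 ↔ ‖x‖ ≤ 1 := by
  rw [norm_univBall_zero sqrt_two_pos]
  set t := ‖x‖ with ht
  have ht0 : 0 ≤ t := norm_nonneg x
  have hs : 0 < √(1 + t ^ 2) := Real.sqrt_pos.2 (by positivity)
  rw [show √2 * (√(1 + t ^ 2))⁻¹ * t = (√2 * t) / √(1 + t ^ 2) by ring, div_le_one hs,
    Real.le_sqrt (by positivity) (by positivity), mul_pow, Real.sq_sqrt (by norm_num : (0:ℝ) ≤ 2)]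
  constructor
  · intro h1; nlinarith
  · intro h1; nlinarith

/-- `univBall 0 √2` is the identity on the unit sphere. [folklore] -/
theorem univBall_sqrt_two_of_norm_eq_one {E : Type*} [NormedAddCommGroup E]
    [InnerProductSpace ℝ E] {x : E} (hx : ‖x‖ = 1) : univBall (0 : E) (√2) x = x := by
  rw [univBall_zero_apply_of_norm_eq_one sqrt_two_pos hx,
    mul_inv_cancel₀ (ne_of_gt sqrt_two_pos), one_smul]

/-- `‖univBall 0 √2 x‖ < √2`. [folklore] -/
theorem norm_univBall_sqrt_two_lt {E : Type*} [NormedAddCommGroup E]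
    [InnerProductSpace ℝ E] (x : E) : ‖univBall (0 : E) (√2) x‖ < √2 :=
  norm_univBall_zero_lt sqrt_two_pos x

/-- The differential of `univBall 0 r` is injective everywhere (it is a diffeomorphism onto the
ball: `univBall⁻¹ ∘ univBall = id`, chain rule). [folklore] -/
theorem injective_fderiv_univBall {E : Type*} [NormedAddCommGroup E] [InnerProductSpace ℝ E]
    {r : ℝ} (hr : 0 < r) (x : E) : Injective (fderiv ℝ (univBall (0 : E) r) x) := by
  set B := univBall (0 : E) r with hB
  have hsrc : ∀ z, z ∈ B.source := fun z ↦ by simp [hB, univBall_source]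
  have hBd : HasFDerivAt B (fderiv ℝ B x) x :=
    ((contDiff_univBall (c := (0 : E)) (r := r) (n := 1)).differentiable (by simp) x).hasFDerivAt
  have hx' : B x ∈ Metric.ball (0 : E) r := by
    rw [← univBall_target (0 : E) hr]
    exact B.map_source (hsrc x)
  have hSdiff : DifferentiableOn ℝ B.symm (Metric.ball (0 : E) r) :=
    (contDiffOn_univBall_symm (c := (0 : E)) (r := r) (n := 1)).differentiableOn (by simp)
  have hSd : HasFDerivAt B.symm (fderiv ℝ B.symm (B x)) (B x) :=
    (hSdiff.differentiableAt (Metric.isOpen_ball.mem_nhds hx')).hasFDerivAt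
  have hcomp := hSd.comp x hBd
  have hid : HasFDerivAt (B.symm ∘ B) (ContinuousLinearMap.id ℝ E) x := by
    have hfun : (B.symm ∘ B : E → E) = id := funext fun z ↦ B.left_inv (hsrc z)
    rw [hfun]
    exact hasFDerivAt_id x
  have heq := hcomp.unique hid
  intro v w hvw
  have key := congrArg (fderiv ℝ B.symm (B x)) hvw
  rw [← ContinuousLinearMap.comp_apply, ← ContinuousLinearMap.comp_apply, heq] at key
  simpa using key

/-- `univBall 0 r : E → E` is a smooth embedding with (open) range the ball. [folklore] -/
theorem isOpenMap_univBall {E : Type*} [NormedAddCommGroup E] [InnerProductSpace ℝ E]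
    (r : ℝ) : IsOpenMap (univBall (0 : E) r) := fun s hs ↦
  (univBall (0 : E) r).isOpen_image_of_subset_source hs (by simp [univBall_source])

/-- **Shrinking a slice disc datum.** Precomposing ball and disc with `univBall 0 √2` (identity
on the unit spheres, preserving the open and closed unit balls) gives a slice disc datum whose
maps have images `e(B(0,√2))` and `f(B(0,√2))`. [folklore] -/
theorem isSliceDiscIn_shrink {K : Knot} {M : Type} [TopologicalSpace M] [ChartedSpace (𝔼 4) M]
    [IsManifold (𝓡 4) ∞ M] {e : 𝔼 4 → M} {f : 𝔼 2 → M} (h : K.IsSliceDiscIn M e f) :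
    K.IsSliceDiscIn M (e ∘ univBall (0 : 𝔼 4) (√2)) (f ∘ univBall (0 : 𝔼 2) (√2)) := by
  have hn : (∞ : ℕ∞ω) ≠ 0 := by simp
  set B₄ := univBall (0 : 𝔼 4) (√2) with hB₄
  set B₂ := univBall (0 : 𝔼 2) (√2) with hB₂
  have hsrc₄ : ∀ z, z ∈ B₄.source := fun z ↦ by simp [hB₄, univBall_source]
  have hsrc₂ : ∀ z, z ∈ B₂.source := fun z ↦ by simp [hB₂, univBall_source]
  -- the ball
  have ho : IsOpen (range e) :=
    (h.isSmoothEmbedding.isLocalDiffeomorph_of_finrank_eq rfl).isOpen_range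
  have hB₄s : ContMDiff (𝓡 4) (𝓡 4) ∞ B₄ :=
    (contDiff_univBall (c := (0 : 𝔼 4)) (r := √2)).contMDiff
  have hrange₄ : range B₄ = Metric.ball (0 : 𝔼 4) (√2) := by
    rw [← univBall_target (0 : 𝔼 4) sqrt_two_pos, ← B₄.image_source_eq_target, hB₄,
      univBall_source, image_univ]
  have hB₄inv : ContMDiffOn (𝓡 4) (𝓡 4) ∞ B₄.symm (range B₄) := by
    rw [hrange₄]
    exact (contDiffOn_univBall_symm (c := (0 : 𝔼 4)) (r := √2)).contMDiffOn
  have he : Manifold.IsSmoothEmbedding (𝓡 4) (𝓡 4) ∞ (e ∘ B₄) :=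
    (isSmoothEmbedding_comp_of_inverse h.isSmoothEmbedding ho hB₄s
      (fun x y hxy ↦ B₄.injOn (hsrc₄ x) (hsrc₄ y) hxy) (isOpenMap_univBall _) hB₄inv
      (fun z ↦ B₄.left_inv (hsrc₄ z)) (ContinuousLinearEquiv.refl ℝ (𝔼 4))).1
  -- the disc
  have hB₂s : ContMDiff (𝓡 2) (𝓡 2) ∞ B₂ :=
    (contDiff_univBall (c := (0 : 𝔼 2)) (r := √2)).contMDiff
  have hmaps : MapsTo B₂ 𝔻² 𝔻² := fun x hx ↦ by
    rw [Metric.mem_closedBall, dist_zero_right] at hx ⊢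
    exact (norm_univBall_sqrt_two_le_one_iff x).2 hx
  refine ⟨he, h.contMDiff.comp hB₂s, h.injOn.comp (fun x _ y _ hxy ↦
    B₂.injOn (hsrc₂ x) (hsrc₂ y) hxy) hmaps, ?_, ?_, ?_⟩
  · intro x hx
    rw [mfderiv_comp x (h.contMDiff.mdifferentiableAt hn) (hB₂s.mdifferentiableAt hn)]
    refine (h.mfderiv_injective (hmaps hx)).comp ?_
    rw [mfderiv_eq_fderiv]
    exact injective_fderiv_univBall sqrt_two_pos x
  · rintro x hx ⟨y, hy, hxy⟩
    refine h.apply_notMem ((norm_univBall_sqrt_two_lt_one_iff x).2 hx) ⟨B₄ y, ?_, hxy⟩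
    rw [Metric.mem_closedBall, dist_zero_right] at hy ⊢
    exact (norm_univBall_sqrt_two_le_one_iff y).2 hy
  · intro x
    have hx : ‖(x : 𝔼 2)‖ = 1 := by simp
    have hKx : ‖((K x : 𝕊 3) : 𝔼 4)‖ = 1 := by simp
    show f (B₂ x) = e (B₄ (K x))
    rw [univBall_sqrt_two_of_norm_eq_one hx, univBall_sqrt_two_of_norm_eq_one hKx,
      h.apply_sphere x]

end Shrink

/-! ### Tool 4: general position of a point against a disc -/

/-- **General position.** For a smooth embedding `e : ℝ⁴ → M⁴` and a smooth map `f : ℝ² → M`,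
some point `e y` with `‖y‖ > 2` misses `f(C)` (any `C ⊆ ℝ²`): the set `{y | e y ∈ f(ℝ²)}` is
the image of a planar set under the `C¹` map `e⁻¹ ∘ f ∘ π`, hence Lebesgue-null (mini-Sard,
`addHaar_image_eq_zero_of_differentiableOn_of_addHaar_eq_zero`), while `{‖y‖ > 2}` has positive
measure. [folklore] -/
theorem exists_norm_gt_apply_notMem_image {M : Type} [TopologicalSpace M]
    [ChartedSpace (𝔼 4) M] [IsManifold (𝓡 4) ∞ M] {e : 𝔼 4 → M}
    (he : Manifold.IsSmoothEmbedding (𝓡 4) (𝓡 4) ∞ e) {f : 𝔼 2 → M}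
    (hf : ContMDiff (𝓡 2) (𝓡 4) ∞ f) (C : Set (𝔼 2)) :
    ∃ y : 𝔼 4, 2 < ‖y‖ ∧ e y ∉ f '' C := by
  classical
  -- the planar parametrisation of the bad set
  set T : Set (𝔼 2) := f ⁻¹' (range e) with hT
  have hTo : IsOpen T :=
    (he.isLocalDiffeomorph_of_finrank_eq rfl).isOpen_range.preimage hf.continuous
  set g : 𝔼 2 → 𝔼 4 := invFun e ∘ f with hg
  have hgT : ContMDiffOn (𝓡 2) (𝓡 4) ∞ g T :=
    (contMDiffOn_invFun_range he).comp hf.contMDiffOn fun x hx ↦ hx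
  have hgd : ∀ x ∈ T, DifferentiableAt ℝ g x := fun x hx ↦
    ((contMDiffOn_iff_contDiffOn.mp hgT).differentiableOn (by simp)).differentiableAt
      (hTo.mem_nhds hx)
  set G : 𝔼 4 → 𝔼 4 := g ∘ (Knot.Puncture.π : 𝔼 4 →L[ℝ] 𝔼 2) with hG
  set Z : Set (𝔼 4) := (Knot.Puncture.ι : 𝔼 2 →L[ℝ] 𝔼 4) '' T with hZ
  -- `Z` lies in a proper subspace, hence is null
  have hZ0 : volume Z = 0 := by
    have hS : LinearMap.range ((Knot.Puncture.ι : 𝔼 2 →L[ℝ] 𝔼 4) : 𝔼 2 →ₗ[ℝ] 𝔼 4) ≠ ⊤ := by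
      intro htop
      have h1 := LinearMap.finrank_range_le ((Knot.Puncture.ι : 𝔼 2 →L[ℝ] 𝔼 4) : 𝔼 2 →ₗ[ℝ] 𝔼 4)
      rw [htop, finrank_top, finrank_euclideanSpace_fin, finrank_euclideanSpace_fin] at h1
      omega
    refine measure_mono_null ?_ (Measure.addHaar_submodule volume _ hS)
    rintro _ ⟨x, -, rfl⟩
    exact LinearMap.mem_range_self _ x
  have hGZ : DifferentiableOn ℝ G Z := by
    rintro _ ⟨x, hx, rfl⟩
    have hgx : DifferentiableAt ℝ g ((Knot.Puncture.π : 𝔼 4 →L[ℝ] 𝔼 2) (Knot.Puncture.ι x)) := by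
      rw [Knot.Puncture.π_ι]; exact hgd x hx
    exact (hgx.comp _ (Knot.Puncture.π : 𝔼 4 →L[ℝ] 𝔼 2).differentiableAt).differentiableWithinAt
  -- the bad set is contained in `G '' Z`
  have hA : e ⁻¹' (f '' C) ⊆ G '' Z := by
    rintro y ⟨x, hxC, hxy⟩
    have hxT : x ∈ T := ⟨y, hxy.symm⟩
    refine ⟨Knot.Puncture.ι x, ⟨x, hxT, rfl⟩, ?_⟩
    show invFun e (f (Knot.Puncture.π (Knot.Puncture.ι x))) = y
    rw [Knot.Puncture.π_ι, hxy]
    exact leftInverse_invFun he.isEmbedding.injective y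
  have hA0 : volume (e ⁻¹' (f '' C)) = 0 :=
    measure_mono_null hA
      (addHaar_image_eq_zero_of_differentiableOn_of_addHaar_eq_zero volume hGZ hZ0)
  -- an open set of positive measure is not null
  set O : Set (𝔼 4) := {y | 2 < ‖y‖} with hO
  have hOo : IsOpen O := isOpen_lt continuous_const continuous_norm
  have hOne : O.Nonempty := by
    obtain ⟨y₀, hy₀⟩ := NormedSpace.exists_lt_norm ℝ (𝔼 4) 2
    exact ⟨y₀, hy₀⟩
  have hOpos : 0 < volume O := hOo.measure_pos volume hOne
  by_contra hcon
  have hsub : O ⊆ e ⁻¹' (f '' C) := fun y hy ↦ by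
    by_contra hy'
    exact hcon ⟨y, hy, hy'⟩
  exact absurd (measure_mono_null hsub hA0) hOpos.ne'

end Summit.SmoothPoincare4.SmoothPoincare4.Theorems

end
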